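import Literature.AlgebraicGeometry.GroupSchemes.UnitComponentReductionKernel
import HarnessLib

/-!
# A connected finite scheme over a henselian local ring has exactly one point in its special fibre

Topic `Literature/AlgebraicGeometry/GroupSchemes`, namespace `Literature.AlgebraicGeometry.GroupSchemes.UnitComponent` (complements to ★
`GroupSchemes/UnitComponentReductionKernel`, whose `isLocalRing_of_connectedSpace` and `finite_structureRingHom` are the engine).  THEOREMS ONLY
(no definition, no named fact, no instance, no notation, no `sorry`).  Generic form of `stub_b1e_unitComponentSpecialFibre` (ED. 2 of the organ
sub-line `Cruxes/HLiu418/Lines/F0_P6b_ConnectedEtale.lean`, cell `pub/hodgecm-mathlib`, P6 «MOD», HEART input (b1) ∕ DICT (b4′) «canonical line»: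
`(G_κ̄)⁰ = (G⁰)_κ̄`); `--supports stmt-HodgeConjecture-24832`.  HONEST LABEL: HC_CM is proved only modulo the cell's 2 remaining named inputs
(hLiu418 24832, h413 24833) until rung 0 closes; this file pays no letter by itself.

THE MATHEMATICS.  `R` henselian local, `X → Spec R` FINITE with `X` CONNECTED.  Then `X = Spec S`, `S` module-finite over `R`, so `S` is a finite
product of local rings ([StacksProject] Tag 04GG (1) ⇒ (10)) and connectedness leaves ONE factor: `S` is LOCAL (★ `isLocalRing_of_connectedSpace`).
The primes of a local algebra integral over a local ring lying over `𝔪_R` are exactly `{𝔪_S}` (a prime over a maximal ideal is maximal, Mathlib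
`Ideal.isMaximal_of_isIntegral_of_isMaximal_comap`; `𝔪_S` contracts to a maximal ideal), so the special fibre of `X` has exactly ONE point.  For
the unit component `G⁰ ↪ G` of a finite group scheme ([Tate1997FiniteFlatGroupSchemes] (3.7) (I): `G⁰` is a clopen connected closed subgroup
scheme) this says: the special fibre of `G⁰` is the unit point alone.  HENSELIAN is needed (over a non-henselian local base a connected finite `X`
can have a disconnected special fibre); no flatness and no group structure are used.

* §1 `comap_eq_maximalIdeal_iff` (algebra), §2 **`natCard_specialFibre_eq_one`** (any connected finite `X` over `Spec R`),
  `natCard_specialFibre_eq_one_of_isClosedImmersion` (the unit-component form: `j : G₀ ⟶ G` a closed immersion, `G` finite, `G₀` connected).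

## References
* [StacksProject] The Stacks Project, Tag 04GG (henselian local rings: finite algebras are products of local rings).
* [Tate1997FiniteFlatGroupSchemes] J. Tate, *Finite flat group schemes*, in: Modular Forms and Fermat's Last Theorem (1997), (3.7) (the connected
  component `G⁰` over a henselian local base).
-/

set_option autoImplicit false

noncomputable section

universe u

open CategoryTheory AlgebraicGeometry IsLocalRing

namespace Literature.AlgebraicGeometry.GroupSchemes.UnitComponent

/-! ### §1 Algebra: a local algebra integral over a local ring has exactly one prime over the maximal ideal -/

/-- For `S` LOCAL and integral over the local ring `R`, a prime `P` of `S` lies over `𝔪_R` iff `P = 𝔪_S` (integrality: a prime over a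
maximal ideal is maximal, Mathlib `Ideal.isMaximal_of_isIntegral_of_isMaximal_comap`; and `𝔪_S` contracts to a maximal ideal, hence to
`𝔪_R`). [cite: StacksProject, Tag 04GG] -/
theorem comap_eq_maximalIdeal_iff {R S : Type*} [CommRing R] [IsLocalRing R] [CommRing S] [IsLocalRing S] [Algebra R S]
    [Algebra.IsIntegral R S] (P : Ideal S) [P.IsPrime] :
    P.comap (algebraMap R S) = maximalIdeal R ↔ P = maximalIdeal S := by
  constructor
  · intro h
    have hmax : (P.comap (algebraMap R S)).IsMaximal := by rw [h]; infer_instance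
    haveI : P.IsMaximal := Ideal.isMaximal_of_isIntegral_of_isMaximal_comap P hmax
    exact IsLocalRing.eq_maximalIdeal inferInstance
  · rintro rfl
    exact IsLocalRing.eq_maximalIdeal (Ideal.isMaximal_comap_of_isIntegral_of_isMaximal (maximalIdeal S))

/-! ### §2 The special fibre of a connected finite scheme over a henselian local ring is a single point -/

/-- **A CONNECTED FINITE scheme over a henselian local ring has EXACTLY ONE point over the closed point.**  `X → Spec R` finite with `X`
connected: `X = Spec S` with `S` module-finite over `R`, hence a finite product of local rings (`R` henselian, [StacksProject] Tag 04GG (10));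
connectedness leaves ONE factor (★ `isLocalRing_of_connectedSpace`), and the primes of the local `S` over `𝔪_R` are `{𝔪_S}` (§1).  (Over a
non-henselian local base this fails: a connected finite `X` may have several points in the special fibre.) [cite: StacksProject, Tag 04GG] -/
theorem natCard_specialFibre_eq_one (R : Type u) [CommRing R] [HenselianLocalRing R] (X : Over (Spec (CommRingCat.of R)))
    [IsFinite X.hom] [ConnectedSpace X.left] : Nat.card {x : X.left // X.hom.base x = closedPoint R} = 1 := by
  haveI : IsAffine X.left := isAffine_of_isAffineHom X.hom
  -- `S = Γ(X, 𝒪)`, module-finite over `R`, connected spectrum, hence LOCAL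
  set φ₀ : CommRingCat.of R ⟶ Γ(X.left, ⊤) := (Scheme.ΓSpecIso (.of R)).inv ≫ X.hom.appTop with hφ₀
  letI : Algebra R Γ(X.left, ⊤) := φ₀.hom.toAlgebra
  haveI : Module.Finite R Γ(X.left, ⊤) := finite_structureRingHom X
  haveI : Algebra.IsIntegral R Γ(X.left, ⊤) := Algebra.IsIntegral.of_finite R _
  haveI : ConnectedSpace (PrimeSpectrum Γ(X.left, ⊤)) :=
    Function.Surjective.connectedSpace (f := X.left.isoSpec.hom.base)
      (ConcreteCategory.bijective_of_isIso X.left.isoSpec.hom.base).2 X.left.isoSpec.hom.base.hom.continuous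
  haveI : IsLocalRing Γ(X.left, ⊤) := isLocalRing_of_connectedSpace R
  -- the structure map on points: `X.hom = isoSpec ≫ Spec φ₀`
  have hX : X.hom = X.left.isoSpec.hom ≫ Spec.map φ₀ := by
    rw [hφ₀, Spec.map_comp, ← Scheme.isoSpec_Spec_inv, ← Category.assoc, Scheme.isoSpec_hom_naturality, Category.assoc,
      Iso.hom_inv_id, Category.comp_id]
  have hpt : ∀ x : X.left, X.hom.base x = closedPoint R ↔ X.left.isoSpec.hom.base x = closedPoint Γ(X.left, ⊤) := by
    intro x
    have h1 : X.hom.base x = (Spec.map φ₀).base (X.left.isoSpec.hom.base x) := by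
      rw [hX]; rfl
    rw [h1]
    change PrimeSpectrum.comap φ₀.hom (X.left.isoSpec.hom.base x) = closedPoint R ↔ _
    constructor
    · intro h
      apply PrimeSpectrum.ext
      refine (comap_eq_maximalIdeal_iff (R := R) (X.left.isoSpec.hom.base x).asIdeal).1 ?_
      exact congrArg PrimeSpectrum.asIdeal h
    · intro h
      rw [h]
      apply PrimeSpectrum.ext
      exact (comap_eq_maximalIdeal_iff (R := R) (maximalIdeal Γ(X.left, ⊤))).2 rfl
  -- one point: the preimage of the closed point of `Spec S`
  have hinj : Function.Injective X.left.isoSpec.hom.base := (ConcreteCategory.bijective_of_isIso X.left.isoSpec.hom.base).1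
  obtain ⟨x₀, hx₀⟩ := (ConcreteCategory.bijective_of_isIso X.left.isoSpec.hom.base).2 (closedPoint Γ(X.left, ⊤))
  rw [Nat.card_eq_one_iff_unique]
  refine ⟨⟨fun a b => Subtype.ext (hinj (((hpt a.1).1 a.2).trans ((hpt b.1).1 b.2).symm))⟩, ⟨⟨x₀, (hpt x₀).2 hx₀⟩⟩⟩

/-- **The special fibre of a unit component is ONE point**: for `j : G₀ ⟶ G` over `Spec R` (`R` henselian local) with `G → Spec R` finite,
`j` a closed immersion on underlying schemes and `G₀` connected — e.g. the unit component of a finite group scheme,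
[Tate1997FiniteFlatGroupSchemes] (3.7) (I) — `G₀` has exactly one point over the closed point of `Spec R`.
[cite: Tate1997FiniteFlatGroupSchemes, (3.7)] [cite: StacksProject, Tag 04GG] -/
theorem natCard_specialFibre_eq_one_of_isClosedImmersion (R : Type u) [CommRing R] [HenselianLocalRing R]
    (G G₀ : Over (Spec (CommRingCat.of R))) (j : G₀ ⟶ G) [IsClosedImmersion j.left] [ConnectedSpace G₀.left] [IsFinite G.hom] :
    Nat.card {x : G₀.left // G₀.hom.base x = closedPoint R} = 1 := by
  haveI : IsFinite G₀.hom := by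
    rw [← Over.w j]
    exact MorphismProperty.comp_mem _ _ _ inferInstance inferInstance
  exact natCard_specialFibre_eq_one R G₀

end Literature.AlgebraicGeometry.GroupSchemes.UnitComponent

end
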